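import Summits.NavierStokesRegularity.NavierStokesRegularity.Theorems.TypeIIInviscidRelaxationAxisymSwirlRegularCoreReynoldsPlateauAnyLevel
import Summits.NavierStokesRegularity.NavierStokesRegularity.Theorems.TypeIIInviscidRelaxationAxisymSwirlRegularSimilarityTools
import HarnessLib

/-!
# The one-sided radial criterion, ANY gate constant: a subcritical core, HOWEVER THIN, suffices

Helper toward the crux `OneSidedRadialCriterion` (stmt-NavierStokesRegularity-19059, line `subcritical_core_reynolds`,
registered stub `stub_subcriticalCoreReynolds`: «under the gate `r u_r ≥ −Cν` on `{r < δ} × [0,T)` there is a level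
`d₀ < 2` such that for EVERY core width `ξ > 0`, from some `T₁ < T` on, `u_r ≥ −ν d₀/r` at the core points
`0 < r < δ`, `r < ξ√(ν(T−t))`»).  Per-solution consequences of the any-level thin-core criterion
`RadialInflowPlateau.twoLevelReynolds_thinCore_anyLevel` (this supersedes `…OneSidedRadialCriterionThinCore.lean`,
where the gate constant was capped at `4`):

* `twoLevel_anyLevel_tube_nearTop` — thin tube `0 < r ≤ δ`, late start `T₁ < T`, ANY core width `ξ₀ > 0`, core
  level `d₀ < 2`, ANY outer level `Λ₀` ⇒ continuation (Leray similarity + sub-slab bound);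
* `hasSmoothExtensionPast_of_oneThinSubcriticalCore` — **for EVERY gate constant `C` the stub's «EVERY parabolic
  core» weakens to «SOME parabolic core, however thin»**: gate + (`∃ d₀ < 2, ∃ ξ > 0, ∃ T₁ < T`: `u_r ≥ −ν d₀/r` for
  `T₁ ≤ t < T`, `0 < r < δ`, `r < ξ√(ν(T−t))`) ⇒ `HasSmoothExtensionPast ν 0 u T`.  With the necessity already in
  kernel (`SubcriticalCoreReynolds.vanishingCoreReynolds_of_hasSmoothExtensionPast`: a continued solution has core
  Reynolds number `→ 0` in every core) the crux ⟨19059⟩ is therefore equivalent, per solution and for every `C`, to the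
  existence of ONE thin subcritical parabolic core near `T`;
* `nearCritical_deepCore_of_blowup` — blow-up reading: under a gate (any `C`), a solution that does NOT extend past
  `T` shows, for every `d₀ < 2`, every `ξ > 0` and every `T₁ < T`, a time `t ∈ [T₁,T)` and a point with
  `0 < r < min δ (ξ√(ν(T−t)))` where `u_r < −ν d₀/r`: inflow Reynolds numbers in `(d₀, C]` occur at `r/√(ν(T−t)) → 0`,
  arbitrarily deep below the parabolic scale, recurrently up to the blow-up time.

Honest label: CRITERIA and their contrapositive (comparison method).  The registered stub — the existence of even
one subcritical core under the gate at `C ≥ 2` — is NOT proved; nothing here proves `OneSidedRadialCriterion`,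
`AxisymSwirlRegular` or NavierStokesRegularity. [new]
-/

noncomputable section

set_option linter.dupNamespace false

open Set Real
open Literature.Analysis.FluidPDE

namespace Summit.NavierStokesRegularity.NavierStokesRegularity.Theorems.RadialInflowPlateau

open Summit.NavierStokesRegularity.NavierStokesRegularity.Theorems RadialInflowSimilarity
open Summit.NavierStokesRegularity.NavierStokesRegularity.Theorems.ScenarioCensus.LogGate

/-! ## §1 Thin tube, late start -/

/-- **Any-level thin-core two-level criterion on a thin tube, near the blow-up time.**  For every core level
`0 < d₀ < 2`, EVERY outer level `Λ₀ > 0` and EVERY core width `ξ₀ > 0`: in the standing class (with the sub-slab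
bound), if for SOME `δ > 0` and SOME `T₁ < T` the radial velocity obeys, on `{0 < r ≤ δ} × [T₁,T)`, `u_r ≥ −ν d₀/r`
where `r < ξ₀√(ν(T−t))` and `u_r ≥ −νΛ₀/r` where `r ≥ ξ₀√(ν(T−t))`, then the solution extends smoothly past `T`.
Proof: on a thin tube `{0 < r ≤ c}` both clauses hold from `t = 0` (sub-slab bound), outer level `max Λ₀ d₀`; Leray's
similarity with `c` maps them onto the unit-tube hypotheses of `twoLevelReynolds_thinCore_anyLevel` (same `ξ₀`). [new] -/
theorem twoLevel_anyLevel_tube_nearTop {d₀ Λ₀ ξ₀ ν T δ T₁ : ℝ}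
    {u : ℝ → EuclideanSpace ℝ (Fin 3) → EuclideanSpace ℝ (Fin 3)} {p : ℝ → EuclideanSpace ℝ (Fin 3) → ℝ}
    (hd0 : 0 < d₀) (hd2 : d₀ < 2) (hΛ : 0 < Λ₀) (hξ₀ : 0 < ξ₀) (hν : 0 < ν) (hT : 0 < T)
    (hcl : IsClassicalNSSolutionOn (Ico 0 T) ν 0 u p) (hLH : IsLerayHopfOn T ν 0 (u 0) u)
    (hdec : HasRapidSpatialDecay (u 0)) (hbd : ∀ T' < T, ∃ M : ℝ, ∀ t ∈ Icc 0 T', ∀ x, ‖u t x‖ ≤ M)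
    (hax : ∀ t ∈ Ico 0 T, IsAxisymmetric (u t)) (hδ : 0 < δ) (hT₁ : T₁ < T)
    (hfar : ∀ t ∈ Ico 0 T, T₁ ≤ t → ∀ x : EuclideanSpace ℝ (Fin 3), 0 < cylRadius x → cylRadius x ≤ δ →
      ξ₀ * √(ν * (T - t)) ≤ cylRadius x → -(ν * Λ₀ / cylRadius x) ≤ radialVelocity (u t) x)
    (hcore : ∀ t ∈ Ico 0 T, T₁ ≤ t → ∀ x : EuclideanSpace ℝ (Fin 3), 0 < cylRadius x → cylRadius x ≤ δ →
      cylRadius x < ξ₀ * √(ν * (T - t)) → -(ν * d₀ / cylRadius x) ≤ radialVelocity (u t) x) :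
    HasSmoothExtensionPast ν 0 u T := by
  have hΛ1 : 0 < max Λ₀ d₀ := lt_of_lt_of_le hd0 (le_max_right _ _)
  -- the early bound and the thin tube
  set T₀ : ℝ := max T₁ 0 with hT₀_def
  have hT₀T : T₀ < T := max_lt hT₁ hT
  obtain ⟨B, hB⟩ := hbd T₀ hT₀T
  set B' : ℝ := max B 0 + 1 with hB'_def
  have hB'0 : 0 < B' := by rw [hB'_def]; positivity
  have hBB' : B ≤ B' := by rw [hB'_def]; linarith [le_max_left B 0]
  set c : ℝ := min δ (d₀ * ν / B') with hc_def
  have hc : 0 < c := lt_min hδ (div_pos (mul_pos hd0 hν) hB'0)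
  have hcδ : c ≤ δ := min_le_left _ _
  have hcB : c * B' ≤ d₀ * ν := by
    have h1 : c ≤ d₀ * ν / B' := min_le_right _ _
    rwa [le_div_iff₀ hB'0] at h1
  -- both clauses on the thin tube `{0 < r ≤ c}` from `t = 0`
  have hearly : ∀ t ∈ Ico 0 T, t < T₀ → ∀ x : EuclideanSpace ℝ (Fin 3), 0 < cylRadius x → cylRadius x ≤ c →
      -(ν * d₀ / cylRadius x) ≤ radialVelocity (u t) x := by
    intro t ht htT₀ x hx hxc
    have hu : ‖u t x‖ ≤ B := hB t ⟨ht.1, htT₀.le⟩ x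
    have h1 := neg_norm_le_radialVelocity (u t) hx
    have h2 : ‖u t x‖ ≤ ν * d₀ / cylRadius x := by
      rw [le_div_iff₀ hx]
      calc ‖u t x‖ * cylRadius x ≤ B' * c := by
            refine mul_le_mul (hu.trans hBB') hxc (cylRadius_nonneg x) hB'0.le
        _ ≤ ν * d₀ := by linarith [mul_comm c B', mul_comm ν d₀]
    linarith
  have hcore' : ∀ t ∈ Ico 0 T, ∀ x : EuclideanSpace ℝ (Fin 3), 0 < cylRadius x → cylRadius x ≤ c →
      cylRadius x < ξ₀ * √(ν * (T - t)) → -(ν * d₀ / cylRadius x) ≤ radialVelocity (u t) x := by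
    intro t ht x hx hxc hxcore
    by_cases htT₀ : t < T₀
    · exact hearly t ht htT₀ x hx hxc
    · push Not at htT₀
      exact hcore t ht ((le_max_left _ _).trans htT₀) x hx (hxc.trans hcδ) hxcore
  have hfar' : ∀ t ∈ Ico 0 T, ∀ x : EuclideanSpace ℝ (Fin 3), 0 < cylRadius x → cylRadius x ≤ c →
      ξ₀ * √(ν * (T - t)) ≤ cylRadius x → -(ν * max Λ₀ d₀ / cylRadius x) ≤ radialVelocity (u t) x := by
    intro t ht x hx hxc hxfar
    have hmono : -(ν * max Λ₀ d₀ / cylRadius x) ≤ -(ν * d₀ / cylRadius x) := by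
      rw [neg_le_neg_iff]
      refine div_le_div_of_nonneg_right ?_ hx.le
      exact mul_le_mul_of_nonneg_left (le_max_right _ _) hν.le
    by_cases htT₀ : t < T₀
    · exact hmono.trans (hearly t ht htT₀ x hx hxc)
    · push Not at htT₀
      have h1 := hfar t ht ((le_max_left _ _).trans htT₀) x hx (hxc.trans hcδ) hxfar
      have hmono' : -(ν * max Λ₀ d₀ / cylRadius x) ≤ -(ν * Λ₀ / cylRadius x) := by
        rw [neg_le_neg_iff]
        refine div_le_div_of_nonneg_right ?_ hx.le
        exact mul_le_mul_of_nonneg_left (le_max_left _ _) hν.le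
      exact hmono'.trans h1
  -- Leray's similarity with `c`: the thin tube becomes the unit tube
  have hc2 : 0 < c ^ 2 := pow_pos hc 2
  have hTc : 0 < T / c ^ 2 := div_pos hT hc2
  have hmem : ∀ s ∈ Ico 0 (T / c ^ 2), c ^ 2 * s ∈ Ico 0 T := fun s hs =>
    ⟨mul_nonneg hc2.le hs.1, (lt_div_iff₀' hc2).1 hs.2⟩
  obtain ⟨hclw, hLHw, hdecw, haxw⟩ := standingClass_nsRescale hT hcl hLH hdec hax hc
  have hrad : ∀ y : EuclideanSpace ℝ (Fin 3), cylRadius (c • y) = c * cylRadius y := fun y => by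
    rw [cylRadius_smul, abs_of_pos hc]
  have hsqrt : ∀ s : ℝ, s < T / c ^ 2 → c * √(ν * (T / c ^ 2 - s)) = √(ν * (T - c ^ 2 * s)) := by
    intro s hs
    have e : ν * (T - c ^ 2 * s) = c ^ 2 * (ν * (T / c ^ 2 - s)) := by field_simp
    rw [e, Real.sqrt_mul (sq_nonneg c), Real.sqrt_sq hc.le]
  have hextw : HasSmoothExtensionPast ν 0 (nsRescale c u) (T / c ^ 2) := by
    refine twoLevelReynolds_thinCore_anyLevel hd0 hd2 hΛ1 hξ₀ hν hTc hclw hLHw hdecw haxw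
      (fun s hs y hy hy1 hycore => ?_) (fun s hs y hy hy1 hyfar => ?_)
    · -- core clause
      have hx : 0 < cylRadius (c • y) := by rw [hrad]; exact mul_pos hc hy
      have hxc : cylRadius (c • y) ≤ c := by rw [hrad]; nlinarith
      have hxcore : cylRadius (c • y) < ξ₀ * √(ν * (T - c ^ 2 * s)) := by
        rw [hrad, ← hsqrt s hs.2]
        nlinarith [mul_lt_mul_of_pos_left hycore hc]
      have h1 := hcore' (c ^ 2 * s) (hmem s hs) (c • y) hx hxc hxcore
      rw [radialVelocity_nsRescale hc]
      have e : ν * d₀ / cylRadius y = c * (ν * d₀ / cylRadius (c • y)) := by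
        rw [hrad]; field_simp
      rw [e]
      nlinarith
    · -- far clause
      have hx : 0 < cylRadius (c • y) := by rw [hrad]; exact mul_pos hc hy
      have hxc : cylRadius (c • y) ≤ c := by rw [hrad]; nlinarith
      have hxfar : ξ₀ * √(ν * (T - c ^ 2 * s)) ≤ cylRadius (c • y) := by
        rw [hrad, ← hsqrt s hs.2]
        nlinarith [mul_le_mul_of_nonneg_left hyfar hc.le]
      have h1 := hfar' (c ^ 2 * s) (hmem s hs) (c • y) hx hxc hxfar
      rw [radialVelocity_nsRescale hc]
      have e : ν * max Λ₀ d₀ / cylRadius y = c * (ν * max Λ₀ d₀ / cylRadius (c • y)) := by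
        rw [hrad]; field_simp
      rw [e]
      nlinarith
  exact hasSmoothExtensionPast_of_nsRescale hc hextw

/-! ## §2 The crux hypothesis list: ANY gate constant, ONE subcritical core -/

/-- **Any gate constant: ONE subcritical core, however thin, continues the solution.**  In the standing class,
under the gate `r u_r ≥ −Cν` on `{r < δ} × [0,T)` (ANY `C`): if for SOME level `d₀ < 2`, SOME core width `ξ > 0` and
SOME `T₁ < T` the radial velocity obeys `u_r ≥ −ν d₀/r` at the core points `0 < r < δ`, `r < ξ√(ν(T−t))`,
`T₁ ≤ t < T`, then `HasSmoothExtensionPast ν 0 u T`.  (The registered stub asks this for EVERY `ξ`; the tree's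
`SubcriticalCoreReynolds.hasSmoothExtensionPast_of_subcriticalCoreReynolds` needs every `ξ`;
`RadialInflowThinCore.hasSmoothExtensionPast_of_subcriticalThinCore` needed `C < 4`.)  The gate supplies the outer level
`max C 1` on `r ≤ δ/2`; `twoLevel_anyLevel_tube_nearTop` concludes. [new] -/
theorem hasSmoothExtensionPast_of_oneThinSubcriticalCore {ν T C δ : ℝ} (hν : 0 < ν) (hT : 0 < T) (hδ : 0 < δ)
    {u : ℝ → EuclideanSpace ℝ (Fin 3) → EuclideanSpace ℝ (Fin 3)} {p : ℝ → EuclideanSpace ℝ (Fin 3) → ℝ}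
    (hcl : IsClassicalNSSolutionOn (Ico 0 T) ν 0 u p) (hLH : IsLerayHopfOn T ν 0 (u 0) u)
    (hbd : ∀ T' < T, ∃ M : ℝ, ∀ t ∈ Icc 0 T', ∀ x, ‖u t x‖ ≤ M)
    (hax : ∀ t ∈ Ico 0 T, IsAxisymmetric (u t)) (hdec : HasRapidSpatialDecay (u 0))
    (hgate : ∀ t ∈ Ico 0 T, ∀ x : EuclideanSpace ℝ (Fin 3), cylRadius x < δ →
      -(C * ν) ≤ x 0 * u t x 0 + x 1 * u t x 1)
    (hthin : ∃ d₀ ξ T₁ : ℝ, 0 < d₀ ∧ d₀ < 2 ∧ 0 < ξ ∧ T₁ < T ∧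
      ∀ t ∈ Ico 0 T, T₁ ≤ t → ∀ x : EuclideanSpace ℝ (Fin 3), 0 < cylRadius x → cylRadius x < δ →
        cylRadius x < ξ * √(ν * (T - t)) → -(ν * d₀ / cylRadius x) ≤ radialVelocity (u t) x) :
    HasSmoothExtensionPast ν 0 u T := by
  obtain ⟨d₀, ξ, T₁, hd0, hd2, hξ, hT₁, hcore⟩ := hthin
  have hΛ : 0 < max C 1 := lt_of_lt_of_le one_pos (le_max_right _ _)
  refine twoLevel_anyLevel_tube_nearTop hd0 hd2 hΛ hξ hν hT hcl hLH hdec hbd hax (half_pos hδ) hT₁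
    (fun t ht _ x hx hxδ _ => ?_) (fun t ht htT₁ x hx hxδ hxcore => hcore t ht htT₁ x hx (by linarith) hxcore)
  have h1 := hgate t ht x (by linarith)
  rw [radialVelocity_eq_div']
  have h2 : -(ν * max C 1 / cylRadius x) ≤ -(C * ν) / cylRadius x := by
    rw [neg_div]
    refine neg_le_neg (div_le_div_of_nonneg_right ?_ hx.le)
    nlinarith [le_max_left C 1]
  exact h2.trans (div_le_div_of_nonneg_right h1 hx.le)

/-- **Blow-up reading (any gate constant).**  In the standing class, under the gate `r u_r ≥ −Cν` on
`{r < δ} × [0,T)`, a solution that does NOT extend smoothly past `T` shows, for every level `d₀ < 2`, every core width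
`ξ > 0` and every `T₁ < T`, a time `t ∈ [T₁,T)` and a point `x` with `0 < r < δ`, `r < ξ√(ν(T−t))` and
`u_r(t,x) < −ν d₀/r` (inflow Reynolds number in `(d₀, C]` there): near-critical inflow recurs arbitrarily deep below
the parabolic scale, up to the blow-up time. [new] -/
theorem nearCritical_deepCore_of_blowup {ν T C δ : ℝ} (hν : 0 < ν) (hT : 0 < T) (hδ : 0 < δ)
    {u : ℝ → EuclideanSpace ℝ (Fin 3) → EuclideanSpace ℝ (Fin 3)} {p : ℝ → EuclideanSpace ℝ (Fin 3) → ℝ}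
    (hcl : IsClassicalNSSolutionOn (Ico 0 T) ν 0 u p) (hLH : IsLerayHopfOn T ν 0 (u 0) u)
    (hbd : ∀ T' < T, ∃ M : ℝ, ∀ t ∈ Icc 0 T', ∀ x, ‖u t x‖ ≤ M)
    (hax : ∀ t ∈ Ico 0 T, IsAxisymmetric (u t)) (hdec : HasRapidSpatialDecay (u 0))
    (hgate : ∀ t ∈ Ico 0 T, ∀ x : EuclideanSpace ℝ (Fin 3), cylRadius x < δ →
      -(C * ν) ≤ x 0 * u t x 0 + x 1 * u t x 1)
    (hsing : ¬ HasSmoothExtensionPast ν 0 u T) {d₀ ξ T₁ : ℝ} (hd0 : 0 < d₀) (hd2 : d₀ < 2) (hξ : 0 < ξ)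
    (hT₁ : T₁ < T) :
    ∃ t ∈ Ico 0 T, T₁ ≤ t ∧ ∃ x : EuclideanSpace ℝ (Fin 3), 0 < cylRadius x ∧ cylRadius x < δ ∧
      cylRadius x < ξ * √(ν * (T - t)) ∧ radialVelocity (u t) x < -(ν * d₀ / cylRadius x) := by
  by_contra h
  push Not at h
  exact hsing (hasSmoothExtensionPast_of_oneThinSubcriticalCore hν hT hδ hcl hLH hbd hax hdec hgate
    ⟨d₀, ξ, T₁, hd0, hd2, hξ, hT₁, fun t ht htT₁ x hx hxδ hxcore => h t ht htT₁ x hx hxδ hxcore⟩)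

end Summit.NavierStokesRegularity.NavierStokesRegularity.Theorems.RadialInflowPlateau

end
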